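import Mathlib
import Summits.Ventures.PercRepro2.A3CutInvisible
import Summits.Ventures.PercRepro2.A3CutGcLoop

/-!
# The pendant-part reduction to the smaller instance, for both lines
(blind cell PercRepro2, night-1 g32; proofs/NIGHT1-G32.md §6 (E3, E4′))

For `x` a cut vertex with the marks `o, a₁, a₂, b ∈ VB ∪ {x}` and `v` on the other side (`v ∈ VA`),
the hypotheses at `x` may be taken on `G − P` (`loopA ends EA x`: the part's edges turned into loops at
`x`, an instance with fewer non-loop edges): `A3Between_cut_of_loopA`, `FM_cut_of_loopA`,
`HCov_cut_of_loopA` (the (MEANS-a₃) line) complement `HCov_cut_of_leafRow_loopA` (p1's line).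
Standard axioms.
-/

namespace Summit.Ventures.PercRepro2

open UnionCluster CovForm CutV

namespace CovForm

namespace A3Fibre

section Reduce

variable {V : Type*} {E : Type*} [Fintype V] [DecidableEq V] [Fintype E] [DecidableEq E]
  {R : Type*} [Field R] [LinearOrder R] [IsStrictOrderedRing R] {ends : E → Sym2 V} {x v : V}
  {VA VB : Finset V} {EA EB : Set E} [DecidablePred (· ∈ EA)] [DecidablePred (· ∈ EB)] {p : E → R}
  {o a₁ a₂ b : V}

omit [IsStrictOrderedRing R] in
/-- (FM) at the cut vertex on `G − P` is (FM) at the cut vertex on `G`. -/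
lemma FM_x_loopA_iff (h : IsCut ends x ↑VA ↑VB EA EB) (ho : o ∈ insert x VB)
    (h1 : a₁ ∈ insert x VB) (h2 : a₂ ∈ insert x VB) (hb : b ∈ insert x VB) :
    0 ≤ FMfun p ends o a₁ a₂ x b ↔ 0 ≤ FMfun p (loopA ends EA x) o a₁ a₂ x b := by
  rw [FMfun_loopA h ho h1 h2 hb]

/-- **(FM) behind a cut vertex from (FM) at the cut vertex on the smaller instance `G − P`.** -/
theorem FM_cut_of_loopA (hp : IsProbVec p) (h : IsCut ends x ↑VA ↑VB EA EB) (ho : o ∈ insert x VB)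
    (h1 : a₁ ∈ insert x VB) (h2 : a₂ ∈ insert x VB) (hb : b ∈ insert x VB) (hv : v ∈ VA)
    (hx : 0 ≤ FMfun p (loopA ends EA x) o a₁ a₂ x b) : 0 ≤ FMfun p ends o a₁ a₂ v b :=
  FM_cut_of hp h ho h1 h2 hb hv ((FM_x_loopA_iff h ho h1 h2 hb).2 hx)

/-- **(MEANS-a₃) behind a cut vertex from (MEANS-a₃) ∧ (FM) at the cut vertex on `G − P`.** -/
theorem A3Between_cut_of_loopA (hp : IsProbVec p) (h : IsCut ends x ↑VA ↑VB EA EB)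
    (ho : o ∈ insert x VB) (h1 : a₁ ∈ insert x VB) (h2 : a₂ ∈ insert x VB) (hb : b ∈ insert x VB)
    (hv : v ∈ VA) (hxB : A3Between p (loopA ends EA x) o a₁ a₂ x b)
    (hxF : 0 ≤ FMfun p (loopA ends EA x) o a₁ a₂ x b) : A3Between p ends o a₁ a₂ v b :=
  A3Between_cut_of hp h ho h1 h2 hb hv ((A3Between_loopA_iff h ho h1 h2 hb).2 hxB)
    ((FM_x_loopA_iff h ho h1 h2 hb).2 hxF)

/-- **(HCOV) behind a cut vertex from (MEANS-a₃) ∧ (FM) at the cut vertex on `G − P`.** -/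
theorem HCov_cut_of_loopA (hp : IsProbVec p) (h : IsCut ends x ↑VA ↑VB EA EB)
    (ho : o ∈ insert x VB) (h1 : a₁ ∈ insert x VB) (h2 : a₂ ∈ insert x VB) (hb : b ∈ insert x VB)
    (hv : v ∈ VA) (hxB : A3Between p (loopA ends EA x) o a₁ a₂ x b)
    (hxF : 0 ≤ FMfun p (loopA ends EA x) o a₁ a₂ x b) : HCov p ends o a₁ a₂ v b :=
  HCov_cut_of hp h ho h1 h2 hb hv ((A3Between_loopA_iff h ho h1 h2 hb).2 hxB)
    ((FM_x_loopA_iff h ho h1 h2 hb).2 hxF)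

end Reduce

end A3Fibre

end CovForm

end Summit.Ventures.PercRepro2
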